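import Summits.NavierStokesRegularity.FluidComputer.TubeRestartRun
import HarnessLib

/-!
# Restart of the certified tube at a kernel slice: the input class of the stage is the tube itself,
# and the quiet branch at every level

HONEST FRAMING (cell `pub-fluidc`, blueprint seat bp3, gen 15): low prior, high value-of-information
experiment on Tao's machine paradigm; NOT a claim that NS blows up. Everything here concerns the
5-mode quadratic, energy-conserving TRUNCATION `thresholdCircuit` (a superposition of the gates of
[Tao2016AveragedNS, §5]) with an ABSTRACT forcing of sup-size `δ`; nothing is proved about the
Navier–Stokes equations.

What is new relative to `TubeStage` (gen 14: the kernel-checked tube run from the INPUT BOX as a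
`ReachCertificate`, at every level, chained through the idealised design hand-off):

* §1 (companion file `TubeRestartRun.lean`, split off for the topic dir's 400-line rule) `run_fromT`
  — the kernel-checked tube run RESTARTS at every chunk boundary: from the recorded slice `sT k`
  (time `tT k`) the remaining schedule `schedFromT k` (duration `TfromT k`, `tT k + TfromT k = T12t`)
  passes and ends in the final state `sT 48` (crossing flag, hull `HT`).  No new kernel evaluation:
  the 48 chunk theorems `run_0 … run_47` of gen 13, re-indexed.
* §2 `SliceE k` — the SLICE of the tube at time `tT k`: the recorded cross-section `(sT k).B`
  (carrier/clock/trigger intervals, rotor ellipse `2(d-d_c)² + (ã-z_c)² ≤ V`) intersected with the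
  input energy band widened by the drift `10·Gt.δ·Rbt·tT k`.  `SliceE 0 ⊇ InputBox`.
* §3 `sliceStage`, `sliceStageLevel` — THE STAGE FROM A SLICE: for every `k < 48`, a reach
  certificate over the whole mode space, defect `Gt.δ`, cycle `TfromT k + T₃L`, from `SliceE k` to
  the loaded, correctly signed output `ã ≥ zL = 0.9604` (crossing in the hull `HT`, hand-off into the
  re-cut level table, output floor); and the same at every amplitude level `c > 0`.
* §4 `inputBox_flows_into_sliceE` — every `Gt.δ`-forced window from the input box is in `SliceE k`
  at time `tT k`: the certified input class of the gate, read at time `tT k`, is the tube section —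
  in the rotor pair an ellipse of linear size up to `≈ 60×` the input box's.
* §5 `noInput_quiet_level` — the complementary QUIET branch at every level `c > 0` over the level's
  cycle `Tcyc/c` with the level's defect `c²·Gt.δ`: initial energy `≤ c²e`, `e ≤ 1` ⇒
  `ã² ≤ c²(e + 6·10⁻⁵)` throughout (`IsForcedWindow.quiet_output` at radius `c·Rbt`; no rescaling
  lemma is needed because the drift identity `10(c²δ)(c Rbt)(Tcyc/c) = c²·(10 δ Rbt Tcyc)` is exact).

WHY (the hand-off audit in the tube's own coordinates, bp3 gen 15, `code/thgate/g15/slice_fit.py`,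
`handoff_audit.py`; model = the 9-mode two-gate chain of gen 14): after its input RAMP the downstream
gate's state, rescaled by its carrier level, sits ON a kernel slice `k` of this tube to `< 10⁻³`
half-widths in carrier, clock and trigger and inside the energy band; its rotor pair lies INSIDE the
slice ellipse for coupling ratios `Λ ≤ 2` (ellipse value `≤ 0.29`) and `2.3–2.8` radii outside it —
in the output coordinate only — for `Λ ∈ {4, 5.657, 8}`.  So for `Λ ≤ 2` the theorems of §3 apply to
the post-ramp state as they stand; for the design ratio a FATTENED slice is needed (the compiled
in-tree checker restarted at slice 18 with `V × 12` passes and its re-cut level table certifies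
`ã² ≥ 0.9200 c²` in exact rational arithmetic — bp3 gen 15 data, NOT kernel-checked, recorded in the
cell's ASSEMBLY.md §2k).  The ramp window itself (input flux up to `10⁶ × Gt.δ` in certificate units,
`≈ 1` cycle long) is NOT certified by anything in the tree.

PLACEMENT: cell-own results of `pub-fluidc` (topic `FluidComputer` under the host summit); the
vocabulary is the Literature one.  No named facts (D-0026); 0 sorry; no new kernel evaluation.

[cite: Tao2016AveragedNS, §5.5 Thm 5.3 (5.5); §6.1 Remark 6.1]
-/

noncomputable section

open Set Filter Topology
open scoped Pointwise BigOperators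

namespace Summit.NavierStokesRegularity.FluidComputer

open Literature.Analysis.FluidPDE.Tao2016AveragedNS
open Literature.Analysis.FluidPDE.FluidComputer
open Literature.Analysis.FluidPDE.FluidComputer.TubeTable
open Literature.Analysis.FluidPDE.FluidComputer.ThresholdLevelTable (GIt Gt Gt_valid GIt_mem Rbt)
open Literature.Analysis.FluidPDE.FluidComputer.ThresholdLevelTableL
  (LtL T₃L EoutL recut_transfer_reach LtL_B_zero LtL_C_zero)

namespace TubeStage

/-! ### §2. Slices -/

/-- The recorded cross-section of the tube at time `tT k` (real form). [folklore] -/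
def Slice (k : ℕ) : Set (Fin 5 → ℝ) := {X | ((sT k).B.toR 60).mem X}

/-- [folklore] -/
theorem slice_zero : Slice 0 = InputBox := rfl

/-- The input energy band `[E0lo, E0hi]` (`E0lo ≥ 0.99998`, `E0hi ≤ 1.0000232`). [folklore] -/
def E0lo : ℝ := (1152909975391800907 : ℝ) ^ 2 / (2 ^ 60) ^ 2

/-- [folklore] -/
def E0hi : ℝ :=
  ((1152933033821893045 : ℝ) ^ 2 + 11529215046069 ^ 2 + 115292150461 ^ 2) / (2 ^ 60) ^ 2 +
    86469113 / 2 ^ 60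

/-- The energy band at time `tT k`: the input band widened by the drift. [folklore] -/
def energyBand (k : ℕ) : Set (Fin 5 → ℝ) :=
  {X | E0lo - 10 * (Gt.δ * Rbt) * tT k ≤ energy X ∧ energy X ≤ E0hi + 10 * (Gt.δ * Rbt) * tT k}

/-- **The slice with its energy band** — the input region of the restarted stage. [folklore] -/
def SliceE (k : ℕ) : Set (Fin 5 → ℝ) := Slice k ∩ energyBand k

/-- The input box lies in the input energy band. [folklore] -/
theorem inputBox_energy_mem {X : Fin 5 → ℝ} (hX : X ∈ InputBox) : E0lo ≤ energy X ∧ energy X ≤ E0hi := by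
  obtain ⟨⟨ga1, ga2⟩, ⟨gb1, gb2⟩, ⟨gc1, gc2⟩, gV⟩ := hX
  simp only [TubeBoxD.toR, B0t] at ga1 ga2 gb1 gb2 gc1 gc2 gV
  push_cast at ga1 ga2 gb1 gb2 gc1 gc2 gV
  rw [Ignition.energy_five, E0lo, E0hi]
  constructor
  · nlinarith [sq_nonneg (X 1), sq_nonneg (X 2), sq_nonneg (X 3), sq_nonneg (X 4)]
  · nlinarith [sq_nonneg (X 3)]

/-- `InputBox ⊆ SliceE 0`. [folklore] -/
theorem inputBox_subset_sliceE_zero : InputBox ⊆ SliceE 0 := fun X hX =>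
  ⟨hX, by have h := inputBox_energy_mem hX; simp only [energyBand, tT, Finset.sum_range_zero,
    mul_zero, sub_zero, add_zero, mem_setOf_eq]; exact h⟩

/-! ### §3. The stage from a slice -/

/-- **CROSSING FROM A SLICE.** Every `Gt.δ`-forced window of duration `TfromT k` from slice `k < 48`
stays in the cube `‖·‖∞ ≤ Rbt` and crosses the read-out level `C₋` inside the hull `HT`. [folklore] -/
theorem slice_crossing {k : ℕ} (hk : k < NT) {y : ℝ → Fin 5 → ℝ}
    (hW : IsForcedWindow Gt.ε Gt.σ Gt.ν Gt.μ Gt.r Gt.κ Gt.δ (TfromT k) y) (h0 : y 0 ∈ Slice k) :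
    (∀ t ∈ Icc 0 (TfromT k), ∀ i, |y t i| ≤ Rbt) ∧
      ∃ s ∈ Ico 0 (TfromT k), y s 2 = Cminus ∧ HT.memR 60 (y s) := by
  have h := runTube_crossing (P := 60) (n := 12) (by norm_num) GIt_mem Gt_valid (run_fromT hk.le)
    (schedFromT_ne_nil hk) (sT_ch_lt hk) (by rw [sT_NT]; exact levels_lt.2) hW h0
  rw [Rt_eq] at h
  exact h

/-- **HAND-OFF FROM A SLICE.** With the energy band at time `tT k`, the crossing state lies in the
entry box of the re-cut level table (as in `tube_handoff`; the energy bookkeeping uses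
`tT k + TfromT k = T12t`). [folklore] -/
theorem slice_handoff {k : ℕ} (hk : k < NT) {y : ℝ → Fin 5 → ℝ}
    (hW : IsForcedWindow Gt.ε Gt.σ Gt.ν Gt.μ Gt.r Gt.κ Gt.δ (TfromT k) y) (h0 : y 0 ∈ Slice k)
    (hE : y 0 ∈ energyBand k) :
    ∃ s ∈ Ico 0 (TfromT k), (LtL.B 0).mem Gt.κ Gt.r (LtL.C 0) (y s) := by
  obtain ⟨hcube, s, hs, hc, hH⟩ := slice_crossing hk hW h0
  refine ⟨s, hs, ?_⟩
  obtain ⟨⟨ha1, ha2⟩, ⟨hb1, hb2⟩, ⟨hd1, hd2⟩, ⟨hz1, hz2⟩⟩ := hH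
  simp only [HT] at ha1 ha2 hb1 hb2 hd1 hd2 hz1 hz2
  push_cast at ha1 ha2 hb1 hb2 hd1 hd2 hz1 hz2
  have hc' : y s 2 = (117685124146233 : ℝ) / 2 ^ 60 := by rw [hc]; norm_num [Cminus, CLt]
  have hw := slavingResidual_mem_of_box (κ := Gt.κ) (r := Gt.r) (by norm_num [Gt]) (by norm_num [Gt])
    (by norm_num) (by norm_num) (by norm_num) (by norm_num) ⟨ha1, ha2⟩ ⟨hc'.ge, hc'.le⟩ ⟨hd1, hd2⟩
    ⟨hz1, hz2⟩
  simp only [Gt] at hw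
  -- energy: band at `tT k`, drift over `s < TfromT k`, `tT k + TfromT k = T12t = 8863/8192`
  have hdrift := hW.energy_abs_sub_le (R := Rbt) (by norm_num [Rbt])
    (fun t ht i => hcube t ⟨ht.1, ht.2.le⟩ i) s ⟨hs.1, hs.2.le⟩
  obtain ⟨hdr1, hdr2⟩ := abs_le.1 hdrift
  have hKs : 10 * (Gt.δ * Rbt) * s ≤ 10 * (Gt.δ * Rbt) * TfromT k :=
    mul_le_mul_of_nonneg_left hs.2.le (by norm_num [Gt, Rbt])
  have hsum : 10 * (Gt.δ * Rbt) * tT k + 10 * (Gt.δ * Rbt) * TfromT k =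
      10 * (Gt.δ * Rbt) * (8863 / 8192) := by
    rw [← mul_add, tT_add_TfromT hk.le]; norm_num [T12t]
  have F1 : (1152852480645929139 : ℝ) / 2 ^ 60 ≤ E0lo - 10 * (Gt.δ * Rbt) * (8863 / 8192) := by
    norm_num [E0lo, Gt, Rbt]
  have F2 : E0hi + 10 * (Gt.δ * Rbt) * (8863 / 8192) ≤ (1152990529000121906 : ℝ) / 2 ^ 60 := by
    norm_num [E0hi, Gt, Rbt]
  obtain ⟨hE1, hE2⟩ := hE
  rw [LtL_B_zero, LtL_C_zero]
  refine ⟨⟨?_, ?_⟩, ⟨?_, ?_⟩, ?_, ⟨?_, ?_⟩, ⟨?_, ?_⟩, ⟨?_, ?_⟩⟩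
  all_goals try simp only [LevelEntryD.toReal, ThresholdLevelTableL.Bc0]
  all_goals try push_cast
  · exact ha1
  · exact ha2
  · exact hb1
  · exact hb2
  · exact hc'
  · simp only [Gt]; linarith [hw.1]
  · simp only [Gt]; linarith [hw.2]
  · exact hz1
  · exact hz2
  · linarith
  · linarith

/-- **REACH FROM A SLICE: loaded output.** [cite: Tao2016AveragedNS, §5.5 Thm 5.3 (5.5)] -/
theorem slice_reach_outputLoaded {k : ℕ} (hk : k < NT) {y : ℝ → Fin 5 → ℝ}
    (hW : IsForcedWindow Gt.ε Gt.σ Gt.ν Gt.μ Gt.r Gt.κ Gt.δ (TfromT k + T₃L) y) (h0 : y 0 ∈ SliceE k) :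
    ∃ s ∈ Icc 0 (TfromT k + T₃L), EoutL ≤ y s 4 ^ 2 := by
  have hT3 : 0 ≤ T₃L := by norm_num [T₃L]
  obtain ⟨s, hs, hmem⟩ := slice_handoff hk (hW.mono (by linarith)) h0.1 h0.2
  have hW3 : IsForcedWindow Gt.ε Gt.σ Gt.ν Gt.μ Gt.r Gt.κ Gt.δ T₃L (fun t => y (s + t)) :=
    (hW.shift ⟨hs.1, by linarith [hs.2]⟩).mono (by linarith [hs.2])
  obtain ⟨t, ht, hout⟩ := recut_transfer_reach hmem (x := fun t => y (s + t)) (by simp)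
    hW3.continuousOn hW3.defect
  exact ⟨s + t, ⟨by linarith [hs.1, ht.1], by linarith [hs.2, ht.2]⟩, hout⟩

/-- The output coordinate on a recorded slice: `ã ≥ -6·10⁻⁴`. [folklore] -/
theorem output_ge_of_mem_slice {k : ℕ} (hk : k ≤ NT) {X : Fin 5 → ℝ} (hX : X ∈ Slice k) :
    -(6 / 10 ^ 4 : ℝ) ≤ X 4 := by
  obtain ⟨-, -, -, gV⟩ := hX
  simp only [TubeBoxD.toR] at gV
  obtain ⟨hz, hV⟩ := sT_rotor hk
  have hz' : (0 : ℝ) ≤ ((sT k).B.zc : ℝ) / 2 ^ 60 := by positivity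
  have hV' : ((sT k).B.V : ℝ) / 2 ^ 60 ≤ ((6 : ℝ) / 10 ^ 4) ^ 2 := by
    have h1 : ((sT k).B.V : ℝ) ≤ 313081695904 := by exact_mod_cast hV
    have h2 : ((sT k).B.V : ℝ) / 2 ^ 60 ≤ 313081695904 / 2 ^ 60 := by gcongr
    exact h2.trans (by norm_num)
  have hsq : (X 4 - ((sT k).B.zc : ℝ) / 2 ^ 60) ^ 2 ≤ ((6 : ℝ) / 10 ^ 4) ^ 2 := by
    nlinarith [sq_nonneg (X 3 - ((sT k).B.dc : ℝ) / 2 ^ 60)]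
  have h := (abs_le_of_sq_le_sq' hsq (by norm_num)).1
  linarith

/-- **REACH FROM A SLICE with the design sign**: `ã ≥ zL = 0.9604`. [cite: Tao2016AveragedNS, §5.5 Thm 5.3 (5.5)] -/
theorem slice_reach_outputAbove {k : ℕ} (hk : k < NT) {y : ℝ → Fin 5 → ℝ}
    (hW : IsForcedWindow Gt.ε Gt.σ Gt.ν Gt.μ Gt.r Gt.κ Gt.δ (TfromT k + T₃L) y) (h0 : y 0 ∈ SliceE k) :
    ∃ s ∈ Icc 0 (TfromT k + T₃L), y s ∈ outputAbove zL := by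
  obtain ⟨s, hs, hsq⟩ := slice_reach_outputLoaded hk hW h0
  refine ⟨s, hs, ?_⟩
  have hfl := hW.output_ge_affine (by norm_num [Gt]) s hs
  have h4 := output_ge_of_mem_slice hk.le h0.1
  have hT : TfromT k + T₃L ≤ 1.4142 := by
    have h1 := tT_add_TfromT hk.le
    have h2 := tT_nonneg k
    have h3 : T12t + T₃L ≤ 1.4142 := certificate_numbers.2.2.1
    linarith
  have hδs : Gt.δ * s ≤ 1 / 10 ^ 5 := by
    have h1 : Gt.δ ≤ 4 / 10 ^ 6 := by norm_num [Gt]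
    have h2 : s ≤ 1.4142 := hs.2.trans hT
    have h3 : (0 : ℝ) ≤ Gt.δ := by norm_num [Gt]
    nlinarith [hs.1]
  have hlow : -(7 / 10 ^ 4 : ℝ) ≤ y s 4 := by linarith
  rw [mem_outputAbove]
  by_contra hlt
  rw [not_le] at hlt
  have hz := zL_sq_le_EoutL
  have hE : (0.9224 : ℝ) ≤ EoutL := certificate_numbers.1
  by_cases hnn : 0 ≤ y s 4
  · have : y s 4 ^ 2 < zL ^ 2 := by nlinarith [zL_pos]
    linarith
  · rw [not_le] at hnn
    have : y s 4 ^ 2 ≤ (7 / 10 ^ 4) ^ 2 := by nlinarith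
    norm_num at this
    linarith

/-- **The energy budget of the restarted stage**: on `SliceE k`,
`E(p) + 10·Gt.δ·Rbt·(TfromT k + T₃L) ≤ E0hi + 10·Gt.δ·Rbt·Tcyc < Rbt²`. [folklore] -/
theorem sliceE_energy_budget {k : ℕ} (hk : k ≤ NT) {p : Fin 5 → ℝ} (hp : p ∈ SliceE k) :
    energy p + 10 * (Gt.δ * Rbt) * (TfromT k + T₃L) < Rbt ^ 2 := by
  have hE2 := hp.2.2
  have hsum := tT_add_TfromT hk
  have hK : 10 * (Gt.δ * Rbt) * Tcyc ≤ 6 / 10 ^ 5 := by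
    have h1 : 10 * (Gt.δ * Rbt) ≤ 4 / 10 ^ 5 := by norm_num [Gt, Rbt]
    nlinarith [Tcyc_le, Tcyc_pos]
  have hcyc : 10 * (Gt.δ * Rbt) * tT k + 10 * (Gt.δ * Rbt) * (TfromT k + T₃L) =
      10 * (Gt.δ * Rbt) * Tcyc := by rw [Tcyc, ← hsum]; ring
  have hhi : E0hi ≤ 1 + 3 / 10 ^ 5 := by norm_num [E0hi]
  have hRb2 : (106 : ℝ) / 100 ≤ Rbt ^ 2 := by norm_num [Rbt]
  linarith

/-- **THE STAGE FROM SLICE `k`** (`k < 48`): a reach certificate over the whole mode space, defect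
`Gt.δ`, cycle `TfromT k + T₃L`, from the slice with its energy band to the loaded, correctly signed
output `ã ≥ zL`; tube = the energy tube at radius `Rbt`. For `k = 0` it contains the gen-14 stage
(`InputBox ⊆ SliceE 0`, `TfromT 0 + T₃L = Tcyc`). [cite: Tao2016AveragedNS, §5.5 Thm 5.3 (5.5)] -/
def sliceStage {k : ℕ} (hk : k < NT) :
    ReachCertificate (thresholdCircuit Gt.ε Gt.σ Gt.ν Gt.μ Gt.r Gt.κ) univ Gt.δ (TfromT k + T₃L)
      (SliceE k) (outputAbove zL) :=
  stageOfReachFree Gt.ε Gt.σ Gt.ν Gt.μ Gt.r Gt.κ Gt.δ Rbt (TfromT k + T₃L) (SliceE k) (outputAbove zL)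
    (by norm_num [Gt]) (by norm_num [Gt]) (by norm_num [Rbt]) (fun _ hp => sliceE_energy_budget hk.le hp)
    (fun p hp x hx0 hW => slice_reach_outputAbove hk hW (hx0 ▸ hp))

/-- **THE STAGE FROM SLICE `k` AT LEVEL `c > 0`**: input `c • SliceE k`, output `ã ≥ c·zL`, defect
`c²·Gt.δ`, cycle `(TfromT k + T₃L)/c` (bp1's `certificateRescale` along `thresholdCircuit_smul`).
[cite: Tao2016AveragedNS, §5.5 Thm 5.3 (5.5); §6.1 Remark 6.1] -/
def sliceStageLevel {k : ℕ} (hk : k < NT) {c : ℝ} (hc : 0 < c) :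
    ReachCertificate (thresholdCircuit Gt.ε Gt.σ Gt.ν Gt.μ Gt.r Gt.κ) univ (c ^ 2 * Gt.δ)
      ((TfromT k + T₃L) / c) (c • SliceE k) (outputAbove (c * zL)) :=
  certificateCast
    (certificateRescale (thresholdCircuit_smul Gt.ε Gt.σ Gt.ν Gt.μ Gt.r Gt.κ) (sliceStage hk) hc)
    (smul_univ_fin5 hc.ne') rfl rfl rfl (smul_outputAbove hc zL)

/-! ### §4. The certified input class at time `tT k` is the tube section -/

/-- **EVERY FORCED WINDOW FROM THE INPUT BOX IS IN `SliceE k` AT TIME `tT k`** (`k ≤ 48`): the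
cross-section by the soundness of the kernel run up to chunk `k`, the energy band by the drift
estimate in the cube. Hence `sliceStage` serves every state the design pulse can occupy at time
`tT k` under any admissible forcing — and more: the slice is a tube section, not a point's
neighbourhood. [cite: Tao2016AveragedNS, §5.5 Thm 5.3 (5.5)] -/
theorem inputBox_flows_into_sliceE {k : ℕ} (hk : k ≤ NT) {z : ℝ → Fin 5 → ℝ}
    (hW : IsForcedWindow Gt.ε Gt.σ Gt.ν Gt.μ Gt.r Gt.κ Gt.δ (tT k) z) (h0 : z 0 ∈ InputBox) :
    z (tT k) ∈ SliceE k := by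
  rw [← dur_schedToT] at hW ⊢
  have hs := runTube_sound (P := 60) (n := 12) (by norm_num) GIt_mem Gt_valid CLt Rt (schedToT k)
    (sT 0) (sT k) (run_toT hk) z hW h0
  refine ⟨hs.1, ?_⟩
  have hE0 := inputBox_energy_mem h0
  rcases Nat.eq_zero_or_pos k with rfl | hpos
  · have hd : dur (schedToT 0) = 0 := by rw [dur_schedToT, tT, Finset.sum_range_zero]
    simp only [energyBand, mem_setOf_eq, hd, tT, Finset.sum_range_zero, mul_zero, sub_zero, add_zero]
    exact hE0
  · have hcube := hs.2.2.1 (schedToT_ne_nil hpos)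
    have hdrift := hW.energy_abs_sub_le (R := Rbt) (by norm_num [Rbt])
      (fun t ht i => by have h := hcube t ⟨ht.1, ht.2.le⟩ i; rwa [Rt_eq] at h)
      (dur (schedToT k)) ⟨dur_nonneg _, le_rfl⟩
    obtain ⟨hdr1, hdr2⟩ := abs_le.1 hdrift
    simp only [energyBand, mem_setOf_eq, dur_schedToT] at hdr1 hdr2 ⊢
    constructor <;> linarith [hE0.1, hE0.2]

/-! ### §5. The quiet branch at every level -/

/-- **NO INPUT PULSE ⇒ NO OUTPUT, AT EVERY LEVEL.** At level `c > 0`, over the level's cycle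
`Tcyc/c` and with the level's defect `c²·Gt.δ`: if the initial energy is at most `c²·e` with
`e ≤ 1`, then the output mode carries at most `c²(e + 6·10⁻⁵)` at all times. With
`TubeStage.inputBoxStageLevel` this is the gate's dichotomy at every level, for the 5-mode truncated
circuit with an abstract defect; it does not certify stage 4, the ramp, or the cascade. [folklore] -/
theorem noInput_quiet_level {c e : ℝ} (hc : 0 < c) {x : ℝ → Fin 5 → ℝ}
    (he : energy (x 0) ≤ c ^ 2 * e) (he1 : e ≤ 1)
    (hW : IsForcedWindow Gt.ε Gt.σ Gt.ν Gt.μ Gt.r Gt.κ (c ^ 2 * Gt.δ) (Tcyc / c) x) :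
    ∀ t ∈ Icc 0 (Tcyc / c), x t 4 ^ 2 ≤ c ^ 2 * (e + 6 / 10 ^ 5) := by
  have hT0 : 0 ≤ Tcyc / c := div_nonneg Tcyc_pos.le hc.le
  have hδ0 : 0 ≤ c ^ 2 * Gt.δ := mul_nonneg (sq_nonneg _) (by norm_num [Gt])
  have hRb : 0 < c * Rbt := mul_pos hc (by norm_num [Rbt])
  have hc2 : 0 < c ^ 2 := by positivity
  have hdr : 10 * (c ^ 2 * Gt.δ * (c * Rbt)) * (Tcyc / c) = c ^ 2 * (10 * (Gt.δ * Rbt) * Tcyc) := by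
    field_simp
  have hK : 10 * (Gt.δ * Rbt) * Tcyc ≤ 6 / 10 ^ 5 := by
    have h1 : 10 * (Gt.δ * Rbt) ≤ 4 / 10 ^ 5 := by norm_num [Gt, Rbt]
    nlinarith [Tcyc_le, Tcyc_pos]
  have hRb2 : (106 : ℝ) / 100 ≤ Rbt ^ 2 := by norm_num [Rbt]
  have h7 : c ^ 2 * (10 * (Gt.δ * Rbt) * Tcyc) ≤ c ^ 2 * (6 / 10 ^ 5) :=
    mul_le_mul_of_nonneg_left hK hc2.le
  have hE : energy (x 0) + 10 * (c ^ 2 * Gt.δ * (c * Rbt)) * (Tcyc / c) < (c * Rbt) ^ 2 := by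
    rw [hdr, mul_pow]
    have h5 : e + 6 / 10 ^ 5 < Rbt ^ 2 := by linarith
    have h6 : c ^ 2 * (e + 6 / 10 ^ 5) < c ^ 2 * Rbt ^ 2 := mul_lt_mul_of_pos_left h5 hc2
    nlinarith
  intro t ht
  have h1 := hW.quiet_output hT0 hδ0 hRb hE t ht
  have h2 : 10 * (c ^ 2 * Gt.δ * (c * Rbt)) * t ≤ 10 * (c ^ 2 * Gt.δ * (c * Rbt)) * (Tcyc / c) :=
    mul_le_mul_of_nonneg_left ht.2 (by positivity)
  rw [hdr] at h2
  nlinarith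

end TubeStage

end Summit.NavierStokesRegularity.FluidComputer

end
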